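import Summits.BirchSwinnertonDyer.BirchSwinnertonDyer.Theorems.ManinLocalTwoThreePShiftDescentExtend
import Summits.BirchSwinnertonDyer.BirchSwinnertonDyer.Theorems.ManinLocalTwoThreeHeisenbergLiftFiveLe
import HarnessLib

/-!
# The prime-generic descent engine, IV: a HEISENBERG FUNCTION on `G₁ = {a² ≡ 1 (mod p)} ≤ Γ₀(pm)` for `p ≥ 5`
# (route `ManinLocalTwoThree`, cell bsd-f2-manin; cruxes C2 stmt-BirchSwinnertonDyer-22967 / C3 stmt-…-22968; LEAD seat p1 gen 12; the `p³ ∣ N`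
# steps of the LEAD's prime-generic shift-equaliser conjecture = typer's `ShiftEqualiser.PrimeShiftInvariantIsDiamond`)

For `p ≥ 5` the Heisenberg pair `(β, λ) = (a·b, a·c/(pm)) mod p` of the `K_{p,p}` step is additive only on `G₁` (it needs `a² ≡ 1`), so
p2's `HeisenbergFiveLe.exists_heisenbergLift_of_five_le` (additive data on all of `Γ₀(M)`) does not apply verbatim.  This file proves the
same statement ON THE SUBGROUP `G₁`: **`exists_heisenberg_subG1`** — for `p ≥ 5` and additive `β₁, λ₁ : G₁ → ℤ/p` there is `μ : G₁ → ℤ/p`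
with `μ(xy) = μ x + μ y + β₁ x · λ₁ y`.  Proof = p2's, relativised: p2's free presentation `(H, e, ρ)` of `Γ₀(pm)` (`[Γ₀(pm) : H] ∣ 6`,
`h = ±e(ρ h)`); the pull-back `F₁ = e⁻¹(G₁) ≤ FreeGroup ι` is free (Nielsen–Schreier, Mathlib); p2's `exists_heisenberg_on_free` on
`F₁ → G₁` gives the lift on `H ∩ G₁`; `[G₁ : H ∩ G₁] ∣ [Γ₀(pm) : H] ∣ 6` because `G₁ ⊴ Γ₀(pm)` (`relIndex_subG1_dvd`; `G₁` has finite index: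
kernel of `γ ↦ (a_γ mod p)²`); Gaschütz averaging (p2's `exists_coboundary_of_coboundary_on_finiteIndex`) finishes since `6` is a unit
mod `p ≥ 5`.  Nothing about BSD, Manin's conjecture or C2/C3 is asserted here. [cite: DarmonDiamondTaylor1995, Lemma 4.28 (p. 135) (shape only)]
-/

set_option autoImplicit false
set_option linter.dupNamespace false

open scoped MatrixGroups

open CongruenceSubgroup Matrix.SpecialLinearGroup
  Summit.BirchSwinnertonDyer.Rank1Residual.ManinAdditive.NineShiftEqualiser

namespace Summit.BirchSwinnertonDyer.BirchSwinnertonDyer.Theorems.ManinLocalTwoThree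

namespace PShiftEngine

open ThreeShiftDescent TwoShift PShiftTransfer

variable {p : ℕ} [Fact p.Prime] {m : ℕ}

/-! ### §1. `G₁` has finite index; `[G₁ : H ∩ G₁] ∣ [Γ₀(pm) : H]` -/

/-- `−1 ∈ G₁`. [folklore] -/
theorem negOne_mem_subG1 : (⟨-1, negOne_mem_Gamma0⟩ : Gamma0 (p * m)) ∈ subG1 p m := by
  rw [mem_subG1]; simp [ent]

variable (p m) in
/-- The homomorphism `γ ↦ (a_γ mod p)²` to `(ℤ/p)ˣ`, whose kernel is `G₁`. [folklore] -/
noncomputable def sqEnt : Gamma0 (p * m) →* (ZMod p)ˣ where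
  toFun γ := (Units.mk0 (ent (p := p) (γ : SL(2, ℤ)) 0 0) (fun h => by
    have := ent_det (p_dvd_level p m) γ; rw [h, zero_mul] at this; exact zero_ne_one this)) ^ 2
  map_one' := by ext; simp [ent]
  map_mul' x y := by
    apply Units.ext
    simp only [Units.val_mul, Units.val_pow_eq_pow_val, Units.val_mk0]
    rw [ent00_mul (p_dvd_level p m), mul_pow]

/-- `G₁ = ker (γ ↦ (a_γ)²)`. [folklore] -/
theorem subG1_eq_ker : subG1 p m = (sqEnt p m).ker := by
  ext γ
  rw [mem_subG1, MonoidHom.mem_ker]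
  constructor
  · intro h; ext; simp [sqEnt, h]
  · intro h
    have := congrArg (fun u : (ZMod p)ˣ => (u : ZMod p)) h
    simpa [sqEnt] using this

/-- `G₁` has finite index in `Γ₀(pm)`. [folklore] -/
theorem index_subG1_ne_zero : (subG1 p m).index ≠ 0 := by
  rw [subG1_eq_ker, Subgroup.index_ker]
  haveI : Finite (sqEnt p m).range := inferInstance
  exact Nat.card_pos.ne'

/-- **`[G₁ : H ∩ G₁] ∣ [Γ₀(pm) : H]`** for every subgroup `H` (as `G₁` is normal of finite index). [folklore] -/
theorem relIndex_subG1_dvd (H : Subgroup (Gamma0 (p * m))) : H.relIndex (subG1 p m) ∣ H.index := by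
  haveI := subG1_normal (p := p) (m := m)
  have h1 : H.relIndex (subG1 p m) * (subG1 p m).index = (H ⊓ subG1 p m).index := by
    rw [← Subgroup.inf_relIndex_right]; exact Subgroup.relIndex_mul_index inf_le_right
  have h2 : (subG1 p m).relIndex H * H.index = (subG1 p m ⊓ H).index := by
    rw [← Subgroup.inf_relIndex_right]; exact Subgroup.relIndex_mul_index inf_le_right
  obtain ⟨t, ht⟩ := Subgroup.relIndex_dvd_index_of_normal (subG1 p m) H
  have hne : (subG1 p m).relIndex H ≠ 0 := fun h0 => index_subG1_ne_zero (p := p) (m := m) (by rw [ht, h0, zero_mul])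
  refine ⟨t, ?_⟩
  have e : H.relIndex (subG1 p m) * ((subG1 p m).relIndex H * t) = (subG1 p m).relIndex H * H.index := by
    rw [← ht, h1, inf_comm, ← h2]
  have e' : (subG1 p m).relIndex H * (H.relIndex (subG1 p m) * t) = (subG1 p m).relIndex H * H.index := by
    rw [← e]; ring
  exact (Nat.eq_of_mul_eq_mul_left (Nat.pos_of_ne_zero hne) e').symm

/-! ### §2. The Heisenberg function on `G₁` -/

open HeisenbergFiveLe Gaschuetz in
/-- **THE HEISENBERG LIFT ON `G₁`, `p ≥ 5`.**  For additive `β₁, λ₁ : G₁ → ℤ/p` there is `μ : G₁ → ℤ/p` with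
`μ(xy) = μ x + μ y + β₁ x·λ₁ y`. [new: p2's free presentation + Nielsen–Schreier + Gaschütz, relativised to `G₁`] -/
theorem exists_heisenberg_subG1 (hp5 : 5 ≤ p) (β₁ lam₁ : subG1 p m → ZMod p)
    (hβ : ∀ x y, β₁ (x * y) = β₁ x + β₁ y) (hlam : ∀ x y, lam₁ (x * y) = lam₁ x + lam₁ y) :
    ∃ μ : subG1 p m → ZMod p, ∀ x y, μ (x * y) = μ x + μ y + β₁ x * lam₁ y := by
  classical
  obtain ⟨H, ι, e, ρ, hidx, hdec⟩ := exists_kernel_free_presentation (p * m)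
  -- the free subgroup `F₁ = e⁻¹(G₁)` and the restricted presentation map `e₁ : FreeGroup _ →* G₁`
  set F₁ : Subgroup (FreeGroup ι) := (subG1 p m).comap e with hF₁
  let tfg := IsFreeGroup.toFreeGroup F₁
  let e₁ : FreeGroup (IsFreeGroup.Generators F₁) →* subG1 p m :=
    ((e.comp F₁.subtype).codRestrict (subG1 p m) (fun w => w.2)).comp tfg.symm.toMonoidHom
  have he₁ : ∀ w : F₁, ((e₁ (tfg w) : subG1 p m) : Gamma0 (p * m)) = e w := by
    intro w; simp [e₁, tfg]
  obtain ⟨ζ, hζ⟩ := exists_heisenberg_on_free e₁ β₁ lam₁ hβ hlam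
  -- `β₁(−1) = λ₁(−1) = 0` (odd `p`)
  have hp2 : (2 : ZMod p) ≠ 0 := ShiftDescentModP.two_ne_zero_of_odd_prime (by omega)
  set n1 : subG1 p m := ⟨⟨-1, negOne_mem_Gamma0⟩, negOne_mem_subG1⟩ with hn1
  have hn1sq : n1 * n1 = 1 := by
    apply Subtype.ext; apply Subtype.ext; simp [hn1]
  have hβ1 : β₁ 1 = 0 := by have := hβ 1 1; rw [mul_one] at this; linear_combination -this
  have hlam1 : lam₁ 1 = 0 := by have := hlam 1 1; rw [mul_one] at this; linear_combination -this
  have hβneg : β₁ n1 = 0 := by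
    have h := hβ n1 n1; rw [hn1sq, hβ1] at h
    have : (2 : ZMod p) * β₁ n1 = 0 := by linear_combination -h
    exact (mul_eq_zero.mp this).resolve_left hp2
  have hlamneg : lam₁ n1 = 0 := by
    have h := hlam n1 n1; rw [hn1sq, hlam1] at h
    have : (2 : ZMod p) * lam₁ n1 = 0 := by linear_combination -h
    exact (mul_eq_zero.mp this).resolve_left hp2
  -- `ρ h ∈ F₁` for `h ∈ H ∩ G₁`
  have hρF : ∀ (x : subG1 p m) (hx : (x : Gamma0 (p * m)) ∈ H), ρ ⟨x, hx⟩ ∈ F₁ := by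
    intro x hx
    rw [hF₁, Subgroup.mem_comap]
    rcases hdec ⟨x, hx⟩ with h1 | h1
    · rw [← h1]; exact x.2
    · have : e (ρ ⟨(x : Gamma0 (p * m)), hx⟩) = (⟨-1, negOne_mem_Gamma0⟩ : Gamma0 (p * m))⁻¹ * x := by
        rw [eq_inv_mul_iff_mul_eq]; exact h1.symm
      rw [this]
      exact (subG1 p m).mul_mem ((subG1 p m).inv_mem negOne_mem_subG1) x.2
  -- `β₁(e₁ w_x) = β₁ x`, `λ₁(e₁ w_x) = λ₁ x`
  have hval : ∀ (x : subG1 p m) (hx : (x : Gamma0 (p * m)) ∈ H),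
      β₁ (e₁ (tfg ⟨ρ ⟨x, hx⟩, hρF x hx⟩)) = β₁ x ∧ lam₁ (e₁ (tfg ⟨ρ ⟨x, hx⟩, hρF x hx⟩)) = lam₁ x := by
    intro x hx
    rcases hdec ⟨x, hx⟩ with h1 | h1
    · have : e₁ (tfg ⟨ρ ⟨x, hx⟩, hρF x hx⟩) = x := by
        apply Subtype.ext; rw [he₁]; exact h1.symm
      rw [this]; exact ⟨rfl, rfl⟩
    · have : e₁ (tfg ⟨ρ ⟨x, hx⟩, hρF x hx⟩) = n1 * x := by
        apply Subtype.ext; rw [he₁]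
        have h2 : e (ρ ⟨(x : Gamma0 (p * m)), hx⟩) = (⟨-1, negOne_mem_Gamma0⟩ : Gamma0 (p * m))⁻¹ * x := by
          rw [eq_inv_mul_iff_mul_eq]; exact h1.symm
        rw [h2]
        have hinv : (⟨-1, negOne_mem_Gamma0⟩ : Gamma0 (p * m))⁻¹ = ⟨-1, negOne_mem_Gamma0⟩ := by
          rw [inv_eq_iff_mul_eq_one]; apply Subtype.ext; simp
        rw [hinv]; rfl
      rw [this, hβ, hlam, hβneg, hlamneg, zero_add, zero_add]; exact ⟨rfl, rfl⟩
  -- the lift on `H₁ = H ∩ G₁`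
  set H₁ : Subgroup (subG1 p m) := H.comap (subG1 p m).subtype with hH₁
  let μ₀ : subG1 p m → ZMod p := fun x => if hx : (x : Gamma0 (p * m)) ∈ H then ζ (tfg ⟨ρ ⟨x, hx⟩, hρF x hx⟩) else 0
  have hμ₀ : ∀ x ∈ H₁, ∀ y ∈ H₁, μ₀ (x * y) = μ₀ x + μ₀ y + β₁ x * lam₁ y := by
    intro x hx y hy
    have hx' : (x : Gamma0 (p * m)) ∈ H := hx
    have hy' : (y : Gamma0 (p * m)) ∈ H := hy
    have hxy' : ((x * y : subG1 p m) : Gamma0 (p * m)) ∈ H := H.mul_mem hx' hy'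
    simp only [μ₀, dif_pos hx', dif_pos hy', dif_pos hxy']
    have hmul : (⟨ρ ⟨((x * y : subG1 p m) : Gamma0 (p * m)), hxy'⟩, hρF (x * y) hxy'⟩ : F₁) =
        ⟨ρ ⟨x, hx'⟩, hρF x hx'⟩ * ⟨ρ ⟨y, hy'⟩, hρF y hy'⟩ := by
      apply Subtype.ext
      show ρ ⟨((x * y : subG1 p m) : Gamma0 (p * m)), hxy'⟩ = ρ ⟨x, hx'⟩ * ρ ⟨y, hy'⟩
      rw [← map_mul]; rfl
    rw [hmul, map_mul, hζ, (hval x hx').1, (hval y hy').2]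
  -- index bookkeeping and Gaschütz
  have hH₁idx : H₁.index = H.relIndex (subG1 p m) := rfl
  have hdvd : H₁.index ∣ 6 := hH₁idx ▸ (relIndex_subG1_dvd H).trans hidx
  have hidx0 : H₁.index ≠ 0 := fun h0 => by rw [h0] at hdvd; norm_num at hdvd
  haveI : H₁.FiniteIndex := ⟨hidx0⟩
  have hunit : IsUnit ((H₁.index : ℕ) : ZMod p) := by
    rw [isUnit_iff_ne_zero, ne_eq, ZMod.natCast_eq_zero_iff]
    intro hpd
    have hp6 : p ∣ 2 * 3 := dvd_trans hpd hdvd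
    rcases (Nat.Prime.dvd_mul (Fact.out : p.Prime)).mp hp6 with h | h
    · have := Nat.le_of_dvd (by norm_num) h; omega
    · have := Nat.le_of_dvd (by norm_num) h; omega
  exact exists_coboundary_of_coboundary_on_finiteIndex H₁ hunit (fun x y => β₁ x * lam₁ y)
    (twoCocycle_mul hβ hlam) μ₀ hμ₀

end PShiftEngine

end Summit.BirchSwinnertonDyer.BirchSwinnertonDyer.Theorems.ManinLocalTwoThree
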